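import Literature.NumberTheory.LFunctions.Zhang2022.RepairBedLadderCertificatesDeep
import HarnessLib

/-!
# Zhang (2022) rescue bed (D-0124 (3)): a CRT-WHEEL certificate for the minimality sweeps of the all-inert ladder (rule `L1y`)

Topic `Literature/NumberTheory/LFunctions/Zhang2022` (Landau–Siegel audit tree; verdict-neutral), cell landau-siegel, LS RESCUE
PROTOCOL (D-0124) part (3) GENUINE BED, typer seat ls-rescue-typ-1. **Nothing here is a claim about Landau–Siegel zeros; the
programme SEARCHES and TYPES; no claim about Landau–Siegel zeros, Theorems 1–2 of arXiv:2211.02515 or a repaired Margin232 until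
a kernel theorem says so.**

Continuation of `RepairBedLadderCertificatesDeep.lean`. There the minimality half of a rung `D_y^s` of bed-1's rule `L1y`
(`IsLeastAllInert y s D`: the fundamental discriminant of sign `s`, `|D| > 4`, least in absolute value with every prime `p ≤ y`
inert [LehmerLehmerShanks1970]) is a STRIDE-8 sweep: every `N ≡ 3` resp. `5 (mod 8)` below the rung is visited and shown to fail
the Euler-criterion check `allInertCheckNeg y N` / `allInertCheckPos y N` (`sweep8`, ≈ `1.6·10⁵` visits per minute of kernel
time). The five open positive rungs (`y = 67 … 101`, up to `D = 261 153 653`) and the last negative one (`y = 89, 97, 101`,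
`D = −269 497 867`) would need ≈ `5·10⁷` such visits (≈ 110 certificate files). This file replaces the stride `8` by the WHEEL
`Q = 8·3·5·7·11·13·17 = 2 042 040` — the sieve of Lehmer–Lehmer–Shanks's own delay-line sieve computations, done inside the kernel:

* `allBelow f n` — the bounded conjunction `f 0 ∧ ⋯ ∧ f (n−1)` as a structural-recursion Boolean, `allBelow_sound`;
* `wheelRes neg p N` / `wheelInert neg p N` — the Euler-criterion inertness test of `RepairBedLadderCertificatesDeep.inertPowTest`
  at the odd prime `p` for the discriminant `+N` (`neg = false`, residue `N mod p`) or `−N` (`neg = true`, residue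
  `(p − N mod p) mod p`), literally the tests inside `allInertCheckPos` / `allInertCheckNeg`;
* `wheelCert neg c ps lo hi k₀ nk` — THREE NESTED LOOPS: over the `1155` residues `r₁ = 8j + c (mod 9240 = 8·3·5·7·11)`, keeping
  the `30` that are inert at `3, 5, 7, 11`; over their `221` lifts `r = r₁ + 9240·t (mod Q)`, keeping the `1440` inert at `13, 17`;
  and over the candidates `N = r + Q·(k₀ + i)`, `i < nk`, each of which, when `lo ≤ N < hi`, must FAIL the test at some prime of
  the list `ps` (the primes `19 ≤ p ≤ y`). A range of `10⁸` integers costs ≈ `7·10⁴` candidate visits instead of `1.25·10⁷`;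
* **`wheelCert_sound`**: if the certificate holds, every `N ∈ [lo, hi)` with `N ≡ c (mod 8)` that is inert at `3, …, 17` fails at
  some `p ∈ ps` — by `N ≡ N mod 9240 ≡ N mod Q` modulo each wheel prime (`wheelInert_mod_of_dvd`) and `N = N mod Q + Q·⌊N/Q⌋`;
* the interval forms **`allInertCheck_pos_false_of_wheelCert`** / **`allInertCheck_neg_false_of_wheelCert`** (heights
  `17 ≤ y`, `ps ⊆ {odd primes ≤ min(y, 101)}`): `allInertCheck y (±N) = false` for all `lo ≤ N < hi` — the exact shape the rung
  assemblies (`sweep61_pos`, `sweep83_neg`, …, `isLeastAllInert_of_check_pos/neg`) consume.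

No new mathematics: the certified statement is the same finite search; only its kernel cost changes. The rungs themselves are
certified in the companion files `RepairBedLadderWheelNeg.lean` / `RepairBedLadderWheelPos.lean`.

## References

* [LehmerLehmerShanks1970] D. H. Lehmer, E. Lehmer, D. Shanks, *Integer sequences having prescribed quadratic character*,
  Math. Comp. 24 (1970) 433–451, §1–§2 (the sieve problem; the delay-line sieve DLS-127) and Tables.
* [MontgomeryVaughan2007] H. L. Montgomery, R. C. Vaughan, *Multiplicative Number Theory I* (2007), §9.3 (Euler's criterion).
-/

namespace Literature.NumberTheory.LFunctions.Zhang2022.Repair.Bed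

/-! ## A bounded-conjunction combinator -/

/-- `allBelow f n = f (n−1) && ⋯ && f 0`: the Boolean «`f m` for every `m < n`» by structural recursion (evaluated by
`decide +kernel`); the loop primitive of the sieve certificate. [cite: LehmerLehmerShanks1970, §2] -/
def allBelow (f : ℕ → Bool) : ℕ → Bool
  | 0 => true
  | n + 1 => f n && allBelow f n

/-- Soundness of `allBelow`: `allBelow f n → m < n → f m` (each sieve loop visits every index below its bound). [cite: LehmerLehmerShanks1970, §2] -/
theorem allBelow_sound {f : ℕ → Bool} {n : ℕ} (h : allBelow f n = true) {m : ℕ} (hm : m < n) : f m = true := by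
  induction n with
  | zero => omega
  | succ n ih =>
    simp only [allBelow, Bool.and_eq_true] at h
    rcases Nat.lt_succ_iff_lt_or_eq.1 hm with hm | rfl
    · exact ih h.2 hm
    · exact h.1

/-! ## The inertness test at one prime, both signs -/

/-- The residue fed to Euler's criterion at the odd prime `p` for the discriminant `D = +N` (`neg = false`: `N mod p`) or
`D = −N` (`neg = true`: `(−N) mod p = (p − N mod p) mod p`) — literally the arguments of `inertPowTest` inside
`allInertCheckPos` / `allInertCheckNeg`. [cite: MontgomeryVaughan2007, §9.3] -/
def wheelRes (neg : Bool) (p N : ℕ) : ℕ := if neg then (p - N % p) % p else N % p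

/-- «`p` is inert for `D = ±N`» by Euler's criterion in `ℕ` arithmetic (`inertPowTest`). [cite: MontgomeryVaughan2007, §9.3] -/
def wheelInert (neg : Bool) (p N : ℕ) : Bool := inertPowTest p (wheelRes neg p N)

/-- The test at `p` only depends on `N mod p`: reducing `N` modulo any multiple `M` of `p` first does not change it.
[cite: MontgomeryVaughan2007, §9.3] -/
theorem wheelInert_mod_of_dvd (neg : Bool) {p M : ℕ} (h : p ∣ M) (N : ℕ) :
    wheelInert neg p (N % M) = wheelInert neg p N := by
  unfold wheelInert wheelRes
  rw [Nat.mod_mod_of_dvd N h]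

/-! ## The wheel certificate (modulus `Q = 2 042 040 = 9240 · 221`, `9240 = 8·3·5·7·11`, `221 = 13·17`) -/

/-- One candidate `N`: if `lo ≤ N < hi` then `±N` must FAIL the inertness test at some prime of `ps`. [cite: LehmerLehmerShanks1970, §2] -/
def wheelCand (neg : Bool) (ps : List ℕ) (lo hi N : ℕ) : Bool :=
  !(decide (lo ≤ N) && decide (N < hi) && ps.all fun p => wheelInert neg p N)

/-- Innermost loop: the candidates `N = r + Q·(k₀ + i)`, `i < nk`, of one admissible residue `r (mod Q)`. [cite: LehmerLehmerShanks1970, §2] -/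
def wheelInner (neg : Bool) (ps : List ℕ) (lo hi r k₀ nk : ℕ) : Bool :=
  allBelow (fun i => wheelCand neg ps lo hi (r + 2042040 * (k₀ + i))) nk

/-- Middle loop: the `221` lifts `r = r₁ + 9240·t` of a residue `r₁ (mod 9240)`; only those inert at `13` and `17` carry
candidates. [cite: LehmerLehmerShanks1970, §2] -/
def wheelMiddle (neg : Bool) (ps : List ℕ) (lo hi r₁ k₀ nk : ℕ) : Bool :=
  allBelow (fun t =>
    !(wheelInert neg 13 (r₁ + 9240 * t) && wheelInert neg 17 (r₁ + 9240 * t)) ||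
      wheelInner neg ps lo hi (r₁ + 9240 * t) k₀ nk) 221

/-- **The wheel certificate.** Outer loop: the `1155` residues `r₁ = 8j + c (mod 9240)`; only those inert at `3, 5, 7, 11`
(thirty of them) are lifted. `c` is the residue mod `8` forced by «`2` inert» (`5` for `D = +N`, `3` for `D = −N`), `ps` the
list of primes `19 ≤ p ≤ y` still to be excluded, `[lo, hi)` the range of `N`, `k₀ ≤ ⌊lo/Q⌋`, `k₀ + nk > ⌊hi/Q⌋`.
[cite: LehmerLehmerShanks1970, §2] -/
def wheelCert (neg : Bool) (c : ℕ) (ps : List ℕ) (lo hi k₀ nk : ℕ) : Bool :=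
  allBelow (fun j =>
    !(wheelInert neg 3 (8 * j + c) && wheelInert neg 5 (8 * j + c) && wheelInert neg 7 (8 * j + c) &&
        wheelInert neg 11 (8 * j + c)) ||
      wheelMiddle neg ps lo hi (8 * j + c) k₀ nk) 1155

/-- **Soundness of the wheel certificate**: if `wheelCert neg c ps lo hi k₀ nk` holds (`c < 8`, `k₀ ≤ ⌊lo/Q⌋`,
`⌊hi/Q⌋ < k₀ + nk`), then every `N` with `lo ≤ N < hi`, `N ≡ c (mod 8)` and `±N` inert at `3, 5, 7, 11, 13, 17` FAILS the
inertness test at some prime of `ps`. (The three loops visit exactly `j = ⌊(N mod 9240)/8⌋`, `t = ⌊(N mod Q)/9240⌋`,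
`i = ⌊N/Q⌋ − k₀`.) [cite: LehmerLehmerShanks1970, §2] -/
theorem wheelCert_sound {neg : Bool} {c : ℕ} (hc : c < 8) {ps : List ℕ} {lo hi k₀ nk : ℕ} (hk₀ : k₀ ≤ lo / 2042040)
    (hnk : hi / 2042040 < k₀ + nk) (h : wheelCert neg c ps lo hi k₀ nk = true) {N : ℕ} (h1 : lo ≤ N) (h2 : N < hi)
    (h8 : N % 8 = c) (hsmall : ∀ p ∈ [3, 5, 7, 11, 13, 17], wheelInert neg p N = true) :
    ∃ p ∈ ps, wheelInert neg p N = false := by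
  -- the residues modulo the two wheel levels
  have e₁ : ∀ p ∈ [3, 5, 7, 11], wheelInert neg p (N % 9240) = true := by
    intro p hp
    have hp' : p ∈ [3, 5, 7, 11, 13, 17] := by simp only [List.mem_cons, List.not_mem_nil, or_false] at hp ⊢; omega
    have hd : p ∣ 9240 := by
      simp only [List.mem_cons, List.not_mem_nil, or_false] at hp
      rcases hp with rfl | rfl | rfl | rfl <;> decide
    rw [wheelInert_mod_of_dvd neg hd]
    exact hsmall p hp'
  have e₂ : ∀ p ∈ [13, 17], wheelInert neg p (N % 2042040) = true := by
    intro p hp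
    have hp' : p ∈ [3, 5, 7, 11, 13, 17] := by simp only [List.mem_cons, List.not_mem_nil, or_false] at hp ⊢; omega
    have hd : p ∣ 2042040 := by
      simp only [List.mem_cons, List.not_mem_nil, or_false] at hp
      rcases hp with rfl | rfl <;> decide
    rw [wheelInert_mod_of_dvd neg hd]
    exact hsmall p hp'
  -- level 1: j = (N mod 9240) / 8
  have hm8 : N % 9240 % 8 = N % 8 := Nat.mod_mod_of_dvd N (by decide)
  have hr₁ : 8 * (N % 9240 / 8) + c = N % 9240 := by omega
  have hj : N % 9240 / 8 < 1155 := by have := Nat.mod_lt N (show 0 < 9240 by decide); omega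
  have l1 := allBelow_sound h hj
  beta_reduce at l1
  rw [hr₁, e₁ 3 (by simp), e₁ 5 (by simp), e₁ 7 (by simp), e₁ 11 (by simp)] at l1
  have l1' : wheelMiddle neg ps lo hi (N % 9240) k₀ nk = true := by simpa using l1
  -- level 2: t = (N mod Q) / 9240
  have hmQ : N % 2042040 % 9240 = N % 9240 := Nat.mod_mod_of_dvd N (by decide)
  have hr : N % 9240 + 9240 * (N % 2042040 / 9240) = N % 2042040 := by omega
  have ht : N % 2042040 / 9240 < 221 := by have := Nat.mod_lt N (show 0 < 2042040 by decide); omega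
  have l2 := allBelow_sound l1' ht
  beta_reduce at l2
  rw [hr, e₂ 13 (by simp), e₂ 17 (by simp)] at l2
  have l2' : wheelInner neg ps lo hi (N % 2042040) k₀ nk = true := by simpa using l2
  -- level 3: i = N / Q − k₀
  have hdiv := Nat.mod_add_div N 2042040
  have hk : k₀ ≤ N / 2042040 := le_trans hk₀ (Nat.div_le_div_right h1)
  have hN : N % 2042040 + 2042040 * (k₀ + (N / 2042040 - k₀)) = N := by
    rw [Nat.add_sub_cancel' hk]; exact hdiv
  have hi' : N / 2042040 - k₀ < nk := by
    have := Nat.div_le_div_right (c := 2042040) h2.le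
    omega
  have l3 := allBelow_sound l2' hi'
  beta_reduce at l3
  rw [hN] at l3
  unfold wheelCand at l3
  rw [decide_eq_true h1, decide_eq_true h2] at l3
  by_contra hne
  have hall : (ps.all fun p => wheelInert neg p N) = true :=
    List.all_eq_true.2 fun p hp => by
      cases hw : wheelInert neg p N
      · exact absurd ⟨p, hp, hw⟩ hne
      · rfl
  rw [hall] at l3
  simp at l3

/-- The six wheel primes are odd primes `≤ 101` of the ladder's list. [cite: LehmerLehmerShanks1970, §1] -/
private theorem wheelPrimes_mem : ∀ p ∈ [3, 5, 7, 11, 13, 17], p ∈ oddPrimesUpTo101 ∧ p ≤ 17 := by decide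

/-- **Interval form, positive side.** At a height `17 ≤ y`, a wheel certificate for `D = +N` whose prime list `ps` consists of
odd primes `≤ y` of the ladder's list (`oddPrimesUpTo101`) shows `allInertCheck y N = false` for EVERY `lo ≤ N < hi`: an `N`
failing at `2` (`N mod 8 ≠ 5`) or at a wheel prime fails the check there; the others are the certificate's candidates.
[cite: LehmerLehmerShanks1970, §2] -/
theorem allInertCheck_pos_false_of_wheelCert {y : ℕ} (hy : 17 ≤ y) {ps : List ℕ}
    (hps : ∀ p ∈ ps, p ∈ oddPrimesUpTo101 ∧ p ≤ y) {lo hi k₀ nk : ℕ} (hk₀ : k₀ ≤ lo / 2042040)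
    (hnk : hi / 2042040 < k₀ + nk) (h : wheelCert false 5 ps lo hi k₀ nk = true) {N : ℕ} (h1 : lo ≤ N) (h2 : N < hi) :
    allInertCheck y (N : ℤ) = false := by
  rw [← allInertCheckPos_eq]
  by_contra hc
  rw [Bool.not_eq_false] at hc
  unfold allInertCheckPos at hc
  rw [Bool.and_eq_true, Bool.or_eq_true, List.all_eq_true] at hc
  obtain ⟨h8, hall⟩ := hc
  have h8' : N % 8 = 5 := by
    rcases h8 with h8 | h8
    · simp only [Bool.not_eq_true', decide_eq_false_iff_not] at h8; omega
    · exact beq_iff_eq.mp h8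
  have htest : ∀ p, p ∈ oddPrimesUpTo101 → p ≤ y → wheelInert false p N = true := fun p hp hpy =>
    hall p (List.mem_filter.2 ⟨hp, decide_eq_true hpy⟩)
  obtain ⟨p, hp, hfalse⟩ := wheelCert_sound (by norm_num) hk₀ hnk h h1 h2 h8'
    (fun p hp => htest p (wheelPrimes_mem p hp).1 (le_trans (wheelPrimes_mem p hp).2 hy))
  rw [htest p (hps p hp).1 (hps p hp).2] at hfalse
  exact Bool.noConfusion hfalse

/-- **Interval form, negative side.** The same for `D = −N` (`allInertCheckNeg`, residue class `N ≡ 3 (mod 8)`):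
`allInertCheck y (−N) = false` for every `lo ≤ N < hi`. [cite: LehmerLehmerShanks1970, §2] -/
theorem allInertCheck_neg_false_of_wheelCert {y : ℕ} (hy : 17 ≤ y) {ps : List ℕ}
    (hps : ∀ p ∈ ps, p ∈ oddPrimesUpTo101 ∧ p ≤ y) {lo hi k₀ nk : ℕ} (hk₀ : k₀ ≤ lo / 2042040)
    (hnk : hi / 2042040 < k₀ + nk) (h : wheelCert true 3 ps lo hi k₀ nk = true) {N : ℕ} (h1 : lo ≤ N) (h2 : N < hi) :
    allInertCheck y (-(N : ℤ)) = false := by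
  rw [← allInertCheckNeg_eq]
  by_contra hc
  rw [Bool.not_eq_false] at hc
  unfold allInertCheckNeg at hc
  rw [Bool.and_eq_true, Bool.or_eq_true, List.all_eq_true] at hc
  obtain ⟨h8, hall⟩ := hc
  have h8' : N % 8 = 3 := by
    rcases h8 with h8 | h8
    · simp only [Bool.not_eq_true', decide_eq_false_iff_not] at h8; omega
    · exact beq_iff_eq.mp h8
  have htest : ∀ p, p ∈ oddPrimesUpTo101 → p ≤ y → wheelInert true p N = true := fun p hp hpy =>
    hall p (List.mem_filter.2 ⟨hp, decide_eq_true hpy⟩)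
  obtain ⟨p, hp, hfalse⟩ := wheelCert_sound (by norm_num) hk₀ hnk h h1 h2 h8'
    (fun p hp => htest p (wheelPrimes_mem p hp).1 (le_trans (wheelPrimes_mem p hp).2 hy))
  rw [htest p (hps p hp).1 (hps p hp).2] at hfalse
  exact Bool.noConfusion hfalse

end Literature.NumberTheory.LFunctions.Zhang2022.Repair.Bed
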